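import Literature.NumberTheory.LFunctions.NymanBeurlingRateSmallOrdinates
import Literature.NumberTheory.LFunctions.ZetaCriticalLineRHBound
import HarnessLib

/-!
# Balazard–de Roton 2010: the critical-line input `|ζ(½+iτ)|² ≤ K'(1+|τ|)^{β(τ)}` under RH

Topic `Literature/NumberTheory/LFunctions`; sibling of `NymanBeurlingRateSmallOrdinates.lean` (whose
`iBound_of_pointwise` takes exactly this hypothesis `hZ`) for the named fact
`Literature.NumberTheory.LFunctions.BalazardDeRoton2010_thm1` (`NymanBeurlingRate.lean`).
Everything here is PROVED.

Balazard–de Roton (arXiv:0812.1689, proof of Prop. 14, p. 11) invoke "(14.14.1) de [Titchmarsh]":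
on RH `ζ(½ + it) ≪ exp(A log t/log log t)`, "d'où `|ζ(½+iτ)|² ≤ K'(1+|τ|)^{β(τ)}`" with
`β(τ) = log log log(16+|τ|)/(2 log log(16+|τ|))` (`BalazardDeRoton.betaExp`). The tree now proves
(14.14.1) (`CriticalLineRH.exists_norm_zeta_half_le_exp_of_RH`, `ZetaCriticalLineRHBound.lean`);
this file performs the elementary passage: for large `τ`,
`2A log τ/log log τ ≤ β(τ) log(1+τ)` as soon as `log log log(16+τ) ≥ 8A`
(`norm_sq_zeta_half_le_rpow_betaExp_of_large`); bounded `τ` by compactness; `τ < 0` by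
`ζ(s̄) = conj ζ(s)` (`exists_norm_sq_zeta_half_le_rpow_betaExp`).

## References

* [BalazardDeRoton2010] M. Balazard, A. de Roton, Int. J. Number Theory 6 (2010) 883–903
  (arXiv:0812.1689), proof of Prop. 14.
* [Titchmarsh1986] E. C. Titchmarsh, *The Theory of the Riemann Zeta-Function*, 2nd ed.,
  Thm. 14.14 (A), (14.14.1).
-/

noncomputable section

open Complex Filter Topology Set

open scoped ComplexConjugate

namespace Literature.NumberTheory.LFunctions

namespace BalazardDeRoton

/-- `log log(16 + t) ≤ 2 log log t` for `t ≥ 16` (`log(16+t) ≤ 2 log t`, `log log t ≥ 1`).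
[folklore] -/
lemma loglog_sixteen_add_le {t : ℝ} (ht : 16 ≤ t) :
    Real.log (Real.log (16 + t)) ≤ 2 * Real.log (Real.log t) := by
  have ht0 : 0 < t := by linarith
  have h1 : 16 + t ≤ t ^ 2 := by nlinarith
  have h2 : Real.log (16 + t) ≤ 2 * Real.log t := by
    have := Real.log_le_log (by linarith) h1
    rwa [Real.log_pow, Nat.cast_ofNat] at this
  have hlog16 : 0 < Real.log (16 + t) := Real.log_pos (by linarith)
  have hlogt : Real.exp 1 ≤ Real.log t :=
    exp_one_lt_log_sixteen.le.trans (Real.log_le_log (by norm_num) ht)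
  have h3 : Real.log (Real.log (16 + t)) ≤ Real.log (2 * Real.log t) :=
    Real.log_le_log hlog16 h2
  rw [Real.log_mul (by norm_num) (by linarith [Real.exp_pos 1])] at h3
  have hlog2 : Real.log 2 ≤ 1 := by have := Real.log_two_lt_d9; linarith
  have h4 : 1 ≤ Real.log (Real.log t) := by
    rw [← Real.log_exp 1]
    exact Real.log_le_log (Real.exp_pos 1) hlogt
  linarith

/-- **Large ordinates**: on RH there is `t₁ ≥ 0` with `|ζ(½ + it)|² ≤ (1 + t)^{β(t)}` for all
`t ≥ t₁` — from Titchmarsh (14.14.1) `|ζ(½+it)| ≤ exp(A log t/log log t)` and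
`2A log t/log log t ≤ β(t) log(1+t)` once `log log log(16+t) ≥ 8A`.
[cite: BalazardDeRoton2010, Prop. 14 (proof)] -/
lemma norm_sq_zeta_half_le_rpow_betaExp_of_large (hRH : RiemannHypothesis) :
    ∃ t₁ : ℝ, 0 ≤ t₁ ∧ ∀ t : ℝ, t₁ ≤ t →
      ‖riemannZeta (1 / 2 + t * I)‖ ^ 2 ≤ (1 + t) ^ betaExp t := by
  obtain ⟨C, hC0, hC⟩ := CriticalLineRH.exists_norm_zeta_half_le_exp_of_RH hRH
  refine ⟨max (max (Real.exp (Real.exp 96)) 16) (Real.exp (Real.exp (Real.exp (8 * C)))),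
    by positivity, fun t ht ↦ ?_⟩
  have hT₀ : Real.exp (Real.exp 96) ≤ t := le_trans (le_trans (le_max_left _ _) (le_max_left _ _)) ht
  have h16 : (16 : ℝ) ≤ t := le_trans (le_trans (le_max_right _ _) (le_max_left _ _)) ht
  have hbig : Real.exp (Real.exp (Real.exp (8 * C))) ≤ t := (le_max_right _ _).trans ht
  have ht0 : 0 < t := by linarith
  set L := Real.log t with hL
  set L₂ := Real.log L with hL₂
  have hee : 0 < Real.exp (Real.exp 96) := Real.exp_pos _
  have hLge : Real.exp 96 ≤ L := by
    rw [hL, ← Real.log_exp (Real.exp 96)]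
    exact Real.log_le_log hee hT₀
  have hL0 : 0 < L := (Real.exp_pos 96).trans_le hLge
  have hL₂ge : 96 ≤ L₂ := by
    rw [hL₂, ← Real.log_exp 96]
    exact Real.log_le_log (Real.exp_pos 96) hLge
  have hL₂0 : 0 < L₂ := by linarith
  -- `β(t)` in terms of `u = log(16 + t)`
  have hτ : |t| = t := abs_of_pos ht0
  set u := Real.log (16 + t) with hu
  have hβ : betaExp t = Real.log (Real.log u) / (2 * Real.log u) := by rw [betaExp, hτ]
  obtain ⟨-, hlu, hllu⟩ := log_sixteen_add_bounds t
  rw [hτ, ← hu] at hlu hllu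
  have hlu0 : 0 < Real.log u := by linarith
  have hlogu : Real.log u ≤ 2 * L₂ := loglog_sixteen_add_le h16
  have hllu8 : 8 * C ≤ Real.log (Real.log u) := by
    have h1 : Real.exp (Real.exp (Real.exp (8 * C))) ≤ 16 + t := by linarith
    have h2 : Real.exp (Real.exp (8 * C)) ≤ u := by
      rw [hu, ← Real.log_exp (Real.exp (Real.exp (8 * C)))]
      exact Real.log_le_log (Real.exp_pos _) h1
    have h3 : Real.exp (8 * C) ≤ Real.log u := by
      rw [← Real.log_exp (Real.exp (8 * C))]
      exact Real.log_le_log (Real.exp_pos _) h2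
    rw [← Real.log_exp (8 * C)]
    exact Real.log_le_log (Real.exp_pos _) h3
  -- the exponent comparison
  have hkey : 2 * (C * L / L₂) ≤ betaExp t * Real.log (1 + t) := by
    rw [hβ]
    have hlog1t : L ≤ Real.log (1 + t) := Real.log_le_log ht0 (by linarith)
    have hβ0 : 0 ≤ Real.log (Real.log u) / (2 * Real.log u) := by positivity
    have h1 : 2 * (C * L / L₂) ≤ Real.log (Real.log u) / (2 * Real.log u) * L := by
      rw [show 2 * (C * L / L₂) = (2 * C / L₂) * L by ring]
      refine mul_le_mul_of_nonneg_right ?_ hL0.le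
      rw [div_le_div_iff₀ hL₂0 (by positivity)]
      have e1 := mul_le_mul_of_nonneg_left hlogu (by positivity : 0 ≤ 4 * C)
      have e2 := mul_le_mul_of_nonneg_right hllu8 hL₂0.le
      linarith
    calc 2 * (C * L / L₂) ≤ Real.log (Real.log u) / (2 * Real.log u) * L := h1
      _ ≤ Real.log (Real.log u) / (2 * Real.log u) * Real.log (1 + t) :=
          mul_le_mul_of_nonneg_left hlog1t hβ0
  have hz : ‖riemannZeta (1 / 2 + t * I)‖ ≤ Real.exp (C * L / L₂) := hC t hT₀
  calc ‖riemannZeta (1 / 2 + t * I)‖ ^ 2 ≤ (Real.exp (C * L / L₂)) ^ 2 :=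
        pow_le_pow_left₀ (norm_nonneg _) hz 2
    _ = Real.exp (2 * (C * L / L₂)) := by rw [← Real.exp_nat_mul]; norm_num
    _ ≤ Real.exp (betaExp t * Real.log (1 + t)) := Real.exp_le_exp.2 hkey
    _ = (1 + t) ^ betaExp t := by rw [Real.rpow_def_of_pos (by linarith), mul_comm]

/-- **The input `hZ` of `iBound_of_pointwise`, PROVED under RH** (Balazard–de Roton, proof of
Prop. 14: "(14.14.1) de [Titchmarsh] … d'où `|ζ(½+iτ)|² ≤ K'(1+|τ|)^{β(τ)}`"): there is `K' > 0`
with `|ζ(½ + iτ)|² ≤ K'(1 + |τ|)^{β(τ)}` for every real `τ`.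
[cite: BalazardDeRoton2010, Prop. 14 (proof)] -/
theorem exists_norm_sq_zeta_half_le_rpow_betaExp (hRH : RiemannHypothesis) :
    ∃ K' : ℝ, 0 < K' ∧ ∀ τ : ℝ,
      ‖riemannZeta (1 / 2 + τ * I)‖ ^ 2 ≤ K' * (1 + |τ|) ^ betaExp τ := by
  obtain ⟨t₁, ht₁0, hlarge⟩ := norm_sq_zeta_half_le_rpow_betaExp_of_large hRH
  -- bounded ordinates: compactness
  have hcont : ContinuousOn (fun t : ℝ ↦ ‖riemannZeta (1 / 2 + t * I)‖ ^ 2) (Icc 0 t₁) := by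
    refine Continuous.continuousOn ((continuous_norm.comp ?_).pow 2)
    refine continuous_iff_continuousAt.2 fun t ↦ ?_
    have hne : (1 / 2 : ℂ) + t * I ≠ 1 := by
      intro h
      have := congrArg Complex.re h
      norm_num at this
    exact ContinuousAt.comp (f := fun t : ℝ ↦ (1 / 2 : ℂ) + t * I)
      (differentiableAt_riemannZeta hne).continuousAt
      (by fun_prop : Continuous fun t : ℝ ↦ (1 / 2 : ℂ) + t * I).continuousAt
  obtain ⟨M, hM⟩ := (isCompact_Icc : IsCompact (Icc (0 : ℝ) t₁)).exists_bound_of_continuousOn hcont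
  have hK0 : 0 < max M 1 := lt_max_of_lt_right one_pos
  refine ⟨max M 1, hK0, fun τ ↦ ?_⟩
  -- reduce to `τ ≥ 0`
  have hnorm : ‖riemannZeta (1 / 2 + τ * I)‖ = ‖riemannZeta (1 / 2 + |τ| * I)‖ := by
    rcases le_or_gt 0 τ with h | h
    · rw [abs_of_nonneg h]
    · have e : (1 / 2 : ℂ) + τ * I = conj (1 / 2 + |τ| * I) := by
        rw [abs_of_neg h]
        apply Complex.ext <;> simp
      rw [e, riemannZeta_conj, Complex.norm_conj]
  have hβ : betaExp τ = betaExp |τ| := by rw [betaExp, betaExp, abs_abs]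
  rw [hnorm, hβ]
  set t := |τ| with ht
  have ht0 : 0 ≤ t := abs_nonneg τ
  have hrpow1 : 1 ≤ (1 + t) ^ betaExp t := Real.one_le_rpow (by linarith) (betaExp_nonneg_le t).1
  rcases le_or_gt t₁ t with hbig | hsmall
  · calc ‖riemannZeta (1 / 2 + t * I)‖ ^ 2 ≤ (1 + t) ^ betaExp t := hlarge t hbig
      _ = 1 * (1 + t) ^ betaExp t := (one_mul _).symm
      _ ≤ max M 1 * (1 + t) ^ betaExp t :=
          mul_le_mul_of_nonneg_right (le_max_right _ _) (by linarith)
  · have h1 := hM t ⟨ht0, hsmall.le⟩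
    rw [Real.norm_eq_abs, abs_of_nonneg (by positivity)] at h1
    calc ‖riemannZeta (1 / 2 + t * I)‖ ^ 2 ≤ M := h1
      _ ≤ max M 1 := le_max_left _ _
      _ = max M 1 * 1 := (mul_one _).symm
      _ ≤ max M 1 * (1 + t) ^ betaExp t := mul_le_mul_of_nonneg_left hrpow1 hK0.le

end BalazardDeRoton

end Literature.NumberTheory.LFunctions

end
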